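import Summits.CriticalPhenomena.PercolationContinuityZ3.Theses.PercNearOneGluing
import Summits.CriticalPhenomena.PercolationContinuityZ3.Theorems.PercNearOneGluingAdditiveGluingOneBond
import Summits.CriticalPhenomena.PercolationContinuityZ3.Theorems.PercNearOneGluingAdditiveGluingStarGlueRelay
import Summits.CriticalPhenomena.PercolationContinuityZ3.Theorems.PercNearOneGluingAdditiveGluingStarGlueSmall
import Summits.CriticalPhenomena.PercolationContinuityZ3.Theorems.PercNearOneGluingAdditiveGluingStarGlueSureStar
import Literature.Probability.Percolation.KozmaNitzanPreFKG
import HarnessLib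

/-!
# Line `starglue` — official skeleton v9.1 (lead c6, 2026-08-18; v9.1: three stubs LANDED p174563/p174567/p174568, one residual): star-pair interpolation on the number of FRACTIONAL pairs

Crux (FIXED, by name): `Summit.CriticalPhenomena.PercolationContinuityZ3.Theses.PercNearOneGluing.AdditiveGluing`.

## Idea (why this skeleton replaces the cone/peel kernels v1–v8)

Write the additive Conjecture 1 with a DESIGNATED relay `a`: `g_a(w) := (1 − P_w(a↔b)) − (P_w(o↔A) − P_w(o↔b))`.
For a fixed `a`, `g_a` is AFFINE in every single pair weight (landed `stub_oneBondDecomp_k15`), so along the interpolation of ONE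
pair `e = s(o,y)` at the observer, `g_a(w) = (1 − w e)·g_a(w[e↦0]) + (w e)·g_a(w[e↦1])`.  Induct on the number of FRACTIONAL
non-diagonal pairs (`0 < w e < 1`): both endpoints `w[e↦0]`, `w[e↦1]` have fewer, so additive Conjecture 1 holds at BOTH (for their
own minimisers).  With `a₀ :=` a minimiser of `P_{w[e↦0]}(·↔b)` the `w[e↦0]` end is the induction hypothesis itself; the whole
residual is the `w[e↦1]` end FOR THE SAME `a₀` — the glued star pair `{o,y}` must be "AG-valid" for the UN-glued minimiser:

  STAR(w, o, y, a₀):  `P_{w₁}(o ↔ A) − (1 − P_{w₁}(a₀ ↔ b)) ≤ P_{w₁}(o ↔ b)`,  `w₁ = w[s(o,y) ↦ 1]`, `w s(o,y) = 0`, `a₀ ∈ argmin_A P_w(·↔b)`.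

Equivalently (block form, `S = {o,y}` glued, `H = w`):  `P_H(S ↔ A, S ↮ b) ≤ P_{H/S}(a₀ ↮ b)`  — "BLOCK-AG": it is the K-lines' block
kernel `BG(S, a₀)` with the dead-pocket PENALTY `Σ_W μ(K_S=W)(1 − min_A τ_{−W})` replaced by dead-pocket CREDIT (BG ⟹ BAG), no pockets,
no selection functions, no `A.card` split, no σ-expansion.  Cases of STAR that are theorems NOW:
* no drift (`a₀` still a minimiser at `w₁`): the induction hypothesis at `w₁` (real proof below, `starGlue_of_stubs`);
* `y ∈ A` (incl. `y = b`; WLOG `b ∈ A`) (`stub_starGlueRelay_sg`): one Kozma–Nitzan Lemma 3(ii) exchange with `Q = {a₀ ↮ {o,y}}`;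
* at most two relays besides `b` (`stub_starGlueSmall_sg`): the same exchange, three lines (lead's notes §BAG(2));
* the residual `stub_starGlueDrift_sg`: `b ∈ A`, `y ∉ A`, `3 ≤ (A.erase b).card`, DRIFT (`∃ a, P_{w₁}(a↔b) < P_{w₁}(a₀↔b)`).
Observers whose star is sure/absent are moved off by `stub_sureStar_sg` (sure-cluster transfer / deterministic cluster; contains the
all-`{0,1}` base).  Composition: `addConj1_of_stubs` (strong induction on the fractional count) ⇒ `additiveGluing_of_shapes` ⇒ `additiveGluing_closed`.

Numerics (lead c6, lab/t1–t10, exact partition-lattice engine): STAR 0 violations in ≈ 1.2·10⁴ random instances n ≤ 7 (all tied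
minimisers, ≈ 10 % with drift) and under logit hill-climbing (n = 5, 6; infimum 0 only on the degenerate loci `o ≡ relay`, tied relays);
the stronger designation-free form QBAG `min_A P_H(·↔b) + max_{d∈A} [P_{H/S}(d↔b) − P_H(d↔b)] + P_H(S↔A, S↮b) ≤ 1` also 0 / 1 100 + climbs.
Sibling: crux 4575's line `additive-shortening` has the same step with the weaker positive-pair IH (`stub_additiveShorteningStep`).
-/

namespace Summit.CriticalPhenomena.PercolationContinuityZ3.Cruxes.AdditiveGluing.StarGlue

open MeasureTheory Set Literature.Probability.LatticeModels Literature.Probability.Percolation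
open Summit.CriticalPhenomena.PercolationContinuityZ3.Theses.PercNearOneGluing
open Summit.CriticalPhenomena.PercolationContinuityZ3.Theorems
open scoped Classical BigOperators

/-! ## Registered stubs -/

-- `stub_sureStar_sg`: LANDED (Theorems.stub_sureStar_sg, wave 1 of lead c6) — imported above.

-- `stub_starGlueRelay_sg`: LANDED (Theorems.stub_starGlueRelay_sg, wave 1 of lead c6) — imported above.

-- `stub_starGlueSmall_sg`: LANDED (Theorems.stub_starGlueSmall_sg, wave 1 of lead c6) — imported above.

/-- **STAR, drift residual** (registered stub, L — the research core of the line): `y ∉ A ∪ {b}`, `3 ≤ A.card`, the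
un-glued minimiser `a₀` is NOT a minimiser after gluing (`∃ a ∈ A, P_{w₁}(a↔b) < P_{w₁}(a₀↔b)`), and the additive Conjecture 1 is
known for every weight function with at most as many fractional non-diagonal pairs as `w` (in particular at `w₁` itself, for its own
minimiser).  Claim: `a₀` is still AG-valid at `w₁`. -/
theorem stub_starGlueDrift_sg : ∀ (n : ℕ) (w : Sym2 (Fin n) → unitInterval) (A : Finset (Fin n)) (o y b a₀ : Fin n),
    b ∈ A → o ∉ A → y ≠ o → w s(o, y) = 0 → a₀ ∈ A →
    (∀ a ∈ A, (prodBernoulli w).real (openConn a₀ b) ≤ (prodBernoulli w).real (openConn a b)) →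
    (∀ w' : Sym2 (Fin n) → unitInterval,
      (Finset.univ.filter (fun e : Sym2 (Fin n) => ¬ e.IsDiag ∧ 0 < (w' e : ℝ) ∧ (w' e : ℝ) < 1)).card ≤
        (Finset.univ.filter (fun e : Sym2 (Fin n) => ¬ e.IsDiag ∧ 0 < (w e : ℝ) ∧ (w e : ℝ) < 1)).card →
      ∀ (A' : Finset (Fin n)) (o' b' : Fin n) (t : ℝ), A'.Nonempty →
        (∀ a ∈ A', t ≤ (prodBernoulli w').real (openConn a b')) →
        (prodBernoulli w').real (⋃ a ∈ A', openConn o' a) - (1 - t) ≤ (prodBernoulli w').real (openConn o' b')) →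
    y ∉ A → 3 ≤ (A.erase b).card →
    (∃ a ∈ A, (prodBernoulli (Function.update w s(o, y) 1)).real (openConn a b) <
      (prodBernoulli (Function.update w s(o, y) 1)).real (openConn a₀ b)) →
    (prodBernoulli (Function.update w s(o, y) 1)).real (⋃ a ∈ A, openConn o a)
        - (1 - (prodBernoulli (Function.update w s(o, y) 1)).real (openConn a₀ b))
      ≤ (prodBernoulli (Function.update w s(o, y) 1)).real (openConn o b) := by
  sorry

/-! ## Real proofs: the star-glue step from its cases, and the fractional-pair induction -/

variable {n : ℕ}

/-- The set of fractional non-diagonal pairs of a weight function. -/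
theorem fracFilter_update_subset_erase (w : Sym2 (Fin n) → unitInterval) (e : Sym2 (Fin n)) (q : unitInterval)
    (hq : (q : ℝ) = 0 ∨ (q : ℝ) = 1) :
    Finset.univ.filter (fun e' : Sym2 (Fin n) => ¬ e'.IsDiag ∧ 0 < (Function.update w e q e' : ℝ) ∧
        (Function.update w e q e' : ℝ) < 1) =
      (Finset.univ.filter (fun e' : Sym2 (Fin n) => ¬ e'.IsDiag ∧ 0 < (w e' : ℝ) ∧ (w e' : ℝ) < 1)).erase e := by
  ext e'
  simp only [Finset.mem_filter, Finset.mem_univ, true_and, Finset.mem_erase]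
  by_cases h : e' = e
  · subst h
    simp only [Function.update_self, ne_eq, not_true_eq_false, false_and, iff_false, not_and, not_lt]
    intro _ h0
    rcases hq with h1 | h1
    · rw [h1] at h0; exact absurd h0 (lt_irrefl 0)
    · rw [h1]
  · rw [Function.update_of_ne h]
    simp [h]

/-- The fractional count drops by one when a fractional non-diagonal pair is set to `0` or `1`, and does not increase in general. -/
theorem fracCard_update_le (w : Sym2 (Fin n) → unitInterval) (e : Sym2 (Fin n)) (q : unitInterval)
    (hq : (q : ℝ) = 0 ∨ (q : ℝ) = 1) :
    (Finset.univ.filter (fun e' : Sym2 (Fin n) => ¬ e'.IsDiag ∧ 0 < (Function.update w e q e' : ℝ) ∧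
        (Function.update w e q e' : ℝ) < 1)).card ≤
      (Finset.univ.filter (fun e' : Sym2 (Fin n) => ¬ e'.IsDiag ∧ 0 < (w e' : ℝ) ∧ (w e' : ℝ) < 1)).card := by
  rw [fracFilter_update_subset_erase w e q hq]
  exact Finset.card_le_card (Finset.erase_subset _ _)

theorem fracCard_update_lt (w : Sym2 (Fin n) → unitInterval) (e : Sym2 (Fin n)) (q : unitInterval)
    (hq : (q : ℝ) = 0 ∨ (q : ℝ) = 1) (he : ¬ e.IsDiag) (h0 : 0 < (w e : ℝ)) (h1 : (w e : ℝ) < 1) :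
    (Finset.univ.filter (fun e' : Sym2 (Fin n) => ¬ e'.IsDiag ∧ 0 < (Function.update w e q e' : ℝ) ∧
        (Function.update w e q e' : ℝ) < 1)).card <
      (Finset.univ.filter (fun e' : Sym2 (Fin n) => ¬ e'.IsDiag ∧ 0 < (w e' : ℝ) ∧ (w e' : ℝ) < 1)).card := by
  rw [fracFilter_update_subset_erase w e q hq]
  exact Finset.card_erase_lt_of_mem (Finset.mem_filter.2 ⟨Finset.mem_univ _, he, h0, h1⟩)

/-- The affine one-bond algebra: endpoint margins for the same relay give the margin at `w`. -/
theorem starGlue_algebra {p X₀ X₁ Y₀ Y₁ Z₀ Z₁ t : ℝ} (hp0 : 0 ≤ p) (hp1 : p ≤ 1)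
    (h0 : Y₀ - (1 - Z₀) ≤ X₀) (h1 : Y₁ - (1 - Z₁) ≤ X₁) (ht : t ≤ (1 - p) * Z₀ + p * Z₁) :
    ((1 - p) * Y₀ + p * Y₁) - (1 - t) ≤ (1 - p) * X₀ + p * X₁ := by
  have h0' : Y₀ - X₀ ≤ 1 - Z₀ := by linarith
  have h1' : Y₁ - X₁ ≤ 1 - Z₁ := by linarith
  nlinarith [mul_le_mul_of_nonneg_left h0' (sub_nonneg.2 hp1), mul_le_mul_of_nonneg_left h1' hp0]

/-- **STAR from its registered cases** (real proof): no drift ⇒ induction hypothesis at `w₁`; `y ∈ A ∪ {b}` ⇒ relay stub;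
`A.card ≤ 2` ⇒ small stub; otherwise the drift stub. -/
theorem starGlue_of_stubs
    (hRelay : ∀ (n : ℕ) (w : Sym2 (Fin n) → unitInterval) (A : Finset (Fin n)) (o y b a₀ : Fin n),
      b ∈ A → o ∉ A → y ≠ o → w s(o, y) = 0 → a₀ ∈ A →
      (∀ a ∈ A, (prodBernoulli w).real (openConn a₀ b) ≤ (prodBernoulli w).real (openConn a b)) →
      y ∈ A →
      (prodBernoulli (Function.update w s(o, y) 1)).real (⋃ a ∈ A, openConn o a)
          - (1 - (prodBernoulli (Function.update w s(o, y) 1)).real (openConn a₀ b))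
        ≤ (prodBernoulli (Function.update w s(o, y) 1)).real (openConn o b))
    (hSmall : ∀ (n : ℕ) (w : Sym2 (Fin n) → unitInterval) (A : Finset (Fin n)) (o y b a₀ : Fin n),
      b ∈ A → o ∉ A → y ≠ o → w s(o, y) = 0 → a₀ ∈ A →
      (∀ a ∈ A, (prodBernoulli w).real (openConn a₀ b) ≤ (prodBernoulli w).real (openConn a b)) →
      y ∉ A → (A.erase b).card ≤ 2 →
      (prodBernoulli (Function.update w s(o, y) 1)).real (⋃ a ∈ A, openConn o a)
          - (1 - (prodBernoulli (Function.update w s(o, y) 1)).real (openConn a₀ b))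
        ≤ (prodBernoulli (Function.update w s(o, y) 1)).real (openConn o b))
    (hDrift : ∀ (n : ℕ) (w : Sym2 (Fin n) → unitInterval) (A : Finset (Fin n)) (o y b a₀ : Fin n),
      b ∈ A → o ∉ A → y ≠ o → w s(o, y) = 0 → a₀ ∈ A →
      (∀ a ∈ A, (prodBernoulli w).real (openConn a₀ b) ≤ (prodBernoulli w).real (openConn a b)) →
      (∀ w' : Sym2 (Fin n) → unitInterval,
        (Finset.univ.filter (fun e : Sym2 (Fin n) => ¬ e.IsDiag ∧ 0 < (w' e : ℝ) ∧ (w' e : ℝ) < 1)).card ≤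
          (Finset.univ.filter (fun e : Sym2 (Fin n) => ¬ e.IsDiag ∧ 0 < (w e : ℝ) ∧ (w e : ℝ) < 1)).card →
        ∀ (A' : Finset (Fin n)) (o' b' : Fin n) (t : ℝ), A'.Nonempty →
          (∀ a ∈ A', t ≤ (prodBernoulli w').real (openConn a b')) →
          (prodBernoulli w').real (⋃ a ∈ A', openConn o' a) - (1 - t) ≤ (prodBernoulli w').real (openConn o' b')) →
      y ∉ A → 3 ≤ (A.erase b).card →
      (∃ a ∈ A, (prodBernoulli (Function.update w s(o, y) 1)).real (openConn a b) <
        (prodBernoulli (Function.update w s(o, y) 1)).real (openConn a₀ b)) →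
      (prodBernoulli (Function.update w s(o, y) 1)).real (⋃ a ∈ A, openConn o a)
          - (1 - (prodBernoulli (Function.update w s(o, y) 1)).real (openConn a₀ b))
        ≤ (prodBernoulli (Function.update w s(o, y) 1)).real (openConn o b))
    (n : ℕ) (w : Sym2 (Fin n) → unitInterval) (A : Finset (Fin n)) (o y b a₀ : Fin n)
    (hoA : o ∉ A) (hob : o ≠ b) (hyo : y ≠ o) (hw : w s(o, y) = 0) (ha₀ : a₀ ∈ A)
    (hmin : ∀ a ∈ A, (prodBernoulli w).real (openConn a₀ b) ≤ (prodBernoulli w).real (openConn a b))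
    (hIH : ∀ w' : Sym2 (Fin n) → unitInterval,
      (Finset.univ.filter (fun e : Sym2 (Fin n) => ¬ e.IsDiag ∧ 0 < (w' e : ℝ) ∧ (w' e : ℝ) < 1)).card ≤
        (Finset.univ.filter (fun e : Sym2 (Fin n) => ¬ e.IsDiag ∧ 0 < (w e : ℝ) ∧ (w e : ℝ) < 1)).card →
      ∀ (A' : Finset (Fin n)) (o' b' : Fin n) (t : ℝ), A'.Nonempty →
        (∀ a ∈ A', t ≤ (prodBernoulli w').real (openConn a b')) →
        (prodBernoulli w').real (⋃ a ∈ A', openConn o' a) - (1 - t) ≤ (prodBernoulli w').real (openConn o' b')) :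
    (prodBernoulli (Function.update w s(o, y) 1)).real (⋃ a ∈ A, openConn o a)
        - (1 - (prodBernoulli (Function.update w s(o, y) 1)).real (openConn a₀ b))
      ≤ (prodBernoulli (Function.update w s(o, y) 1)).real (openConn o b) := by
  -- no drift: `a₀` is a minimiser at `w₁`, and the induction hypothesis applies to `w₁` (this needs no `b ∈ A`)
  by_cases hdrift : ∃ a ∈ A, (prodBernoulli (Function.update w s(o, y) 1)).real (openConn a b) <
      (prodBernoulli (Function.update w s(o, y) 1)).real (openConn a₀ b)
  swap
  · push Not at hdrift
    have hcard : (Finset.univ.filter (fun e : Sym2 (Fin n) => ¬ e.IsDiag ∧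
        0 < (Function.update w s(o, y) 1 e : ℝ) ∧ (Function.update w s(o, y) 1 e : ℝ) < 1)).card ≤
        (Finset.univ.filter (fun e : Sym2 (Fin n) => ¬ e.IsDiag ∧ 0 < (w e : ℝ) ∧ (w e : ℝ) < 1)).card :=
      fracCard_update_le w _ 1 (Or.inr rfl)
    have key := hIH _ hcard A o b ((prodBernoulli (Function.update w s(o, y) 1)).real (openConn a₀ b))
      ⟨a₀, ha₀⟩ hdrift
    linarith
  -- WLOG `b ∈ A`: prove the claim for `A⁺ = insert b A` and come back by monotonicity of `o ↔ ·`
  set A' : Finset (Fin n) := insert b A with hA'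
  have hbA' : b ∈ A' := Finset.mem_insert_self b A
  have hoA' : o ∉ A' := by
    rw [hA', Finset.mem_insert]; push Not; exact ⟨hob, hoA⟩
  have ha₀' : a₀ ∈ A' := Finset.mem_insert_of_mem ha₀
  have hbb : ∀ u : Sym2 (Fin n) → unitInterval, (prodBernoulli u).real (openConn b b : Set (BondConfig (Fin n))) = 1 :=
    fun u => by
      have h : (openConn b b : Set (BondConfig (Fin n))) = Set.univ :=
        Set.eq_univ_of_forall fun ω => (SimpleGraph.Reachable.refl b : (openGraph ω).Reachable b b)
      rw [h, probReal_univ]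
  have hmin' : ∀ a ∈ A', (prodBernoulli w).real (openConn a₀ b) ≤ (prodBernoulli w).real (openConn a b) := by
    intro a ha
    rw [hA', Finset.mem_insert] at ha
    rcases ha with rfl | ha
    · rw [hbb]; exact measureReal_le_one
    · exact hmin a ha
  have hdrift' : ∃ a ∈ A', (prodBernoulli (Function.update w s(o, y) 1)).real (openConn a b) <
      (prodBernoulli (Function.update w s(o, y) 1)).real (openConn a₀ b) := by
    obtain ⟨a, ha, h⟩ := hdrift
    exact ⟨a, Finset.mem_insert_of_mem ha, h⟩
  have hmono : (prodBernoulli (Function.update w s(o, y) 1)).real (⋃ a ∈ A, (openConn o a : Set (BondConfig (Fin n)))) ≤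
      (prodBernoulli (Function.update w s(o, y) 1)).real (⋃ a ∈ A', (openConn o a : Set (BondConfig (Fin n)))) := by
    refine measureReal_mono (Set.biUnion_subset_biUnion_left fun a ha => ?_) (measure_ne_top _ _)
    exact Finset.mem_insert_of_mem ha
  suffices h' : (prodBernoulli (Function.update w s(o, y) 1)).real (⋃ a ∈ A', openConn o a)
        - (1 - (prodBernoulli (Function.update w s(o, y) 1)).real (openConn a₀ b))
      ≤ (prodBernoulli (Function.update w s(o, y) 1)).real (openConn o b) by
    linarith
  by_cases hy : y ∈ A'
  · exact hRelay n w A' o y b a₀ hbA' hoA' hyo hw ha₀' hmin' hy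
  have herase : A'.erase b = A.erase b := by rw [hA', Finset.erase_insert_eq_erase]
  by_cases hcard : (A'.erase b).card ≤ 2
  · exact hSmall n w A' o y b a₀ hbA' hoA' hyo hw ha₀' hmin' hy hcard
  · exact hDrift n w A' o y b a₀ hbA' hoA' hyo hw ha₀' hmin' hIH hy (by omega) hdrift'

/-- **Additive Conjecture 1** (min-free typing) from the stubs: strong induction on the number of fractional non-diagonal
pairs; observers with a fractional pair by the one-bond interpolation + STAR, the others by `stub_sureStar_sg`. -/
theorem addConj1_of_stubs
    (hSure : ∀ (n : ℕ) (w : Sym2 (Fin n) → unitInterval) (A : Finset (Fin n)) (o b : Fin n) (t : ℝ),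
      A.Nonempty → (∀ a ∈ A, t ≤ (prodBernoulli w).real (openConn a b)) →
      (∀ y : Fin n, y ≠ o → (w s(o, y) : ℝ) = 0 ∨ (w s(o, y) : ℝ) = 1) →
      (∀ o' : Fin n, (∃ y : Fin n, y ≠ o' ∧ 0 < (w s(o', y) : ℝ) ∧ (w s(o', y) : ℝ) < 1) →
        (prodBernoulli w).real (⋃ a ∈ A, openConn o' a) - (1 - t) ≤ (prodBernoulli w).real (openConn o' b)) →
      (prodBernoulli w).real (⋃ a ∈ A, openConn o a) - (1 - t) ≤ (prodBernoulli w).real (openConn o b))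
    (hStar : ∀ (n : ℕ) (w : Sym2 (Fin n) → unitInterval) (A : Finset (Fin n)) (o y b a₀ : Fin n),
      o ∉ A → o ≠ b → y ≠ o → w s(o, y) = 0 → a₀ ∈ A →
      (∀ a ∈ A, (prodBernoulli w).real (openConn a₀ b) ≤ (prodBernoulli w).real (openConn a b)) →
      (∀ w' : Sym2 (Fin n) → unitInterval,
        (Finset.univ.filter (fun e : Sym2 (Fin n) => ¬ e.IsDiag ∧ 0 < (w' e : ℝ) ∧ (w' e : ℝ) < 1)).card ≤
          (Finset.univ.filter (fun e : Sym2 (Fin n) => ¬ e.IsDiag ∧ 0 < (w e : ℝ) ∧ (w e : ℝ) < 1)).card →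
        ∀ (A' : Finset (Fin n)) (o' b' : Fin n) (t : ℝ), A'.Nonempty →
          (∀ a ∈ A', t ≤ (prodBernoulli w').real (openConn a b')) →
          (prodBernoulli w').real (⋃ a ∈ A', openConn o' a) - (1 - t) ≤ (prodBernoulli w').real (openConn o' b')) →
      (prodBernoulli (Function.update w s(o, y) 1)).real (⋃ a ∈ A, openConn o a)
          - (1 - (prodBernoulli (Function.update w s(o, y) 1)).real (openConn a₀ b))
        ≤ (prodBernoulli (Function.update w s(o, y) 1)).real (openConn o b)) :
    ∀ (n : ℕ) (w : Sym2 (Fin n) → unitInterval) (A : Finset (Fin n)) (o b : Fin n) (t : ℝ),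
      A.Nonempty → (∀ a ∈ A, t ≤ (prodBernoulli w).real (openConn a b)) →
      (prodBernoulli w).real (⋃ a ∈ A, openConn o a) - (1 - t) ≤ (prodBernoulli w).real (openConn o b) := by
  intro n
  suffices H : ∀ k : ℕ, ∀ w : Sym2 (Fin n) → unitInterval,
      (Finset.univ.filter (fun e : Sym2 (Fin n) => ¬ e.IsDiag ∧ 0 < (w e : ℝ) ∧ (w e : ℝ) < 1)).card = k →
      ∀ (A : Finset (Fin n)) (o b : Fin n) (t : ℝ), A.Nonempty →
        (∀ a ∈ A, t ≤ (prodBernoulli w).real (openConn a b)) →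
        (prodBernoulli w).real (⋃ a ∈ A, openConn o a) - (1 - t) ≤ (prodBernoulli w).real (openConn o b) by
    intro w A o b t hA ht
    exact H _ w rfl A o b t hA ht
  intro k
  induction k using Nat.strong_induction_on with
  | _ k ih =>
  intro w hk
  -- the induction hypothesis for every weight function with fewer fractional pairs
  have hIH : ∀ w' : Sym2 (Fin n) → unitInterval,
      (Finset.univ.filter (fun e : Sym2 (Fin n) => ¬ e.IsDiag ∧ 0 < (w' e : ℝ) ∧ (w' e : ℝ) < 1)).card <
        (Finset.univ.filter (fun e : Sym2 (Fin n) => ¬ e.IsDiag ∧ 0 < (w e : ℝ) ∧ (w e : ℝ) < 1)).card →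
      ∀ (A' : Finset (Fin n)) (o' b' : Fin n) (t : ℝ), A'.Nonempty →
        (∀ a ∈ A', t ≤ (prodBernoulli w').real (openConn a b')) →
        (prodBernoulli w').real (⋃ a ∈ A', openConn o' a) - (1 - t) ≤ (prodBernoulli w').real (openConn o' b') := by
    intro w' hlt A' o' b' t' hA' ht'
    exact ih _ (hk ▸ hlt) w' rfl A' o' b' t' hA' ht'
  -- Case A: observers with a fractional pair
  have caseA : ∀ (A : Finset (Fin n)) (o b : Fin n) (t : ℝ), A.Nonempty →
      (∀ a ∈ A, t ≤ (prodBernoulli w).real (openConn a b)) →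
      (∃ y : Fin n, y ≠ o ∧ 0 < (w s(o, y) : ℝ) ∧ (w s(o, y) : ℝ) < 1) →
      (prodBernoulli w).real (⋃ a ∈ A, openConn o a) - (1 - t) ≤ (prodBernoulli w).real (openConn o b) := by
    intro A o b t hA ht hy
    obtain ⟨y, hyo, hp0, hp1⟩ := hy
    have hU1 : (prodBernoulli w).real (⋃ a ∈ A, (openConn o a : Set (BondConfig (Fin n)))) ≤ 1 := measureReal_le_one
    by_cases hoA : o ∈ A
    · have := ht o hoA
      linarith
    by_cases hob : o = b
    · subst hob
      obtain ⟨a, ha⟩ := hA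
      have h1 : (prodBernoulli w).real (openConn a o : Set (BondConfig (Fin n))) ≤ 1 := measureReal_le_one
      have hbb : (prodBernoulli w).real (openConn o o : Set (BondConfig (Fin n))) = 1 := by
        have h : (openConn o o : Set (BondConfig (Fin n))) = Set.univ :=
          Set.eq_univ_of_forall fun ω => (SimpleGraph.Reachable.refl o : (openGraph ω).Reachable o o)
        rw [h, probReal_univ]
      have := ht a ha
      linarith
    -- interpolate along `e = s(o,y)`
    set e : Sym2 (Fin n) := s(o, y) with he
    have hediag : ¬ e.IsDiag := by
      rw [he, Sym2.mk_isDiag_iff]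
      exact fun h => hyo h.symm
    set w₀ : Sym2 (Fin n) → unitInterval := Function.update w e 0 with hw₀
    have hlt0 : (Finset.univ.filter (fun e' : Sym2 (Fin n) => ¬ e'.IsDiag ∧ 0 < (w₀ e' : ℝ) ∧ (w₀ e' : ℝ) < 1)).card <
        (Finset.univ.filter (fun e' : Sym2 (Fin n) => ¬ e'.IsDiag ∧ 0 < (w e' : ℝ) ∧ (w e' : ℝ) < 1)).card :=
      fracCard_update_lt w e 0 (Or.inl rfl) hediag hp0 hp1
    obtain ⟨a₀, ha₀, hmin⟩ := Finset.exists_min_image A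
      (fun a => (prodBernoulli w₀).real (openConn a b : Set (BondConfig (Fin n)))) hA
    have hw₀e : w₀ e = 0 := by rw [hw₀, Function.update_self]
    -- the `w₀` end: induction hypothesis with `t₀ = P_{w₀}(a₀ ↔ b)`
    have h0 := hIH w₀ hlt0 A o b ((prodBernoulli w₀).real (openConn a₀ b)) hA hmin
    -- the `w₁` end: STAR
    have h1 := hStar n w₀ A o y b a₀ hoA hob hyo hw₀e ha₀ hmin
      (fun w' hw' => hIH w' (lt_of_le_of_lt hw' hlt0))
    have hw₁ : Function.update w₀ s(o, y) 1 = Function.update w e 1 := by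
      rw [hw₀, he, Function.update_idem]
    rw [hw₁] at h1
    -- one-bond decompositions
    have hX := stub_oneBondDecomp_k15 n w e (openConn o b)
    have hY := stub_oneBondDecomp_k15 n w e (⋃ a ∈ A, openConn o a)
    have hZ := stub_oneBondDecomp_k15 n w e (openConn a₀ b)
    have hta := ht a₀ ha₀
    rw [hZ] at hta
    rw [hX, hY]
    exact starGlue_algebra (w e).2.1 (w e).2.2 h0 h1 hta
  -- general observer
  intro A o b t hA ht
  by_cases hfr : ∃ y : Fin n, y ≠ o ∧ 0 < (w s(o, y) : ℝ) ∧ (w s(o, y) : ℝ) < 1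
  · exact caseA A o b t hA ht hfr
  · push Not at hfr
    refine hSure n w A o b t hA ht (fun y hy => ?_) (fun o' ho' => caseA A o' b t hA ht ho')
    have h0 : 0 ≤ (w s(o, y) : ℝ) := (w s(o, y)).2.1
    have h1 : (w s(o, y) : ℝ) ≤ 1 := (w s(o, y)).2.2
    rcases h0.lt_or_eq with hpos | hzero
    · exact Or.inr (le_antisymm h1 (hfr y hy hpos))
    · exact Or.inl hzero.symm

/-- **Composition** (unfolded form of the crux) from the four stub shapes, as hypotheses. -/
theorem additiveGluing_of_shapes
    (hSure : ∀ (n : ℕ) (w : Sym2 (Fin n) → unitInterval) (A : Finset (Fin n)) (o b : Fin n) (t : ℝ),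
      A.Nonempty → (∀ a ∈ A, t ≤ (prodBernoulli w).real (openConn a b)) →
      (∀ y : Fin n, y ≠ o → (w s(o, y) : ℝ) = 0 ∨ (w s(o, y) : ℝ) = 1) →
      (∀ o' : Fin n, (∃ y : Fin n, y ≠ o' ∧ 0 < (w s(o', y) : ℝ) ∧ (w s(o', y) : ℝ) < 1) →
        (prodBernoulli w).real (⋃ a ∈ A, openConn o' a) - (1 - t) ≤ (prodBernoulli w).real (openConn o' b)) →
      (prodBernoulli w).real (⋃ a ∈ A, openConn o a) - (1 - t) ≤ (prodBernoulli w).real (openConn o b))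
    (hRelay : ∀ (n : ℕ) (w : Sym2 (Fin n) → unitInterval) (A : Finset (Fin n)) (o y b a₀ : Fin n),
      b ∈ A → o ∉ A → y ≠ o → w s(o, y) = 0 → a₀ ∈ A →
      (∀ a ∈ A, (prodBernoulli w).real (openConn a₀ b) ≤ (prodBernoulli w).real (openConn a b)) →
      y ∈ A →
      (prodBernoulli (Function.update w s(o, y) 1)).real (⋃ a ∈ A, openConn o a)
          - (1 - (prodBernoulli (Function.update w s(o, y) 1)).real (openConn a₀ b))
        ≤ (prodBernoulli (Function.update w s(o, y) 1)).real (openConn o b))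
    (hSmall : ∀ (n : ℕ) (w : Sym2 (Fin n) → unitInterval) (A : Finset (Fin n)) (o y b a₀ : Fin n),
      b ∈ A → o ∉ A → y ≠ o → w s(o, y) = 0 → a₀ ∈ A →
      (∀ a ∈ A, (prodBernoulli w).real (openConn a₀ b) ≤ (prodBernoulli w).real (openConn a b)) →
      y ∉ A → (A.erase b).card ≤ 2 →
      (prodBernoulli (Function.update w s(o, y) 1)).real (⋃ a ∈ A, openConn o a)
          - (1 - (prodBernoulli (Function.update w s(o, y) 1)).real (openConn a₀ b))
        ≤ (prodBernoulli (Function.update w s(o, y) 1)).real (openConn o b))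
    (hDrift : ∀ (n : ℕ) (w : Sym2 (Fin n) → unitInterval) (A : Finset (Fin n)) (o y b a₀ : Fin n),
      b ∈ A → o ∉ A → y ≠ o → w s(o, y) = 0 → a₀ ∈ A →
      (∀ a ∈ A, (prodBernoulli w).real (openConn a₀ b) ≤ (prodBernoulli w).real (openConn a b)) →
      (∀ w' : Sym2 (Fin n) → unitInterval,
        (Finset.univ.filter (fun e : Sym2 (Fin n) => ¬ e.IsDiag ∧ 0 < (w' e : ℝ) ∧ (w' e : ℝ) < 1)).card ≤
          (Finset.univ.filter (fun e : Sym2 (Fin n) => ¬ e.IsDiag ∧ 0 < (w e : ℝ) ∧ (w e : ℝ) < 1)).card →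
        ∀ (A' : Finset (Fin n)) (o' b' : Fin n) (t : ℝ), A'.Nonempty →
          (∀ a ∈ A', t ≤ (prodBernoulli w').real (openConn a b')) →
          (prodBernoulli w').real (⋃ a ∈ A', openConn o' a) - (1 - t) ≤ (prodBernoulli w').real (openConn o' b')) →
      y ∉ A → 3 ≤ (A.erase b).card →
      (∃ a ∈ A, (prodBernoulli (Function.update w s(o, y) 1)).real (openConn a b) <
        (prodBernoulli (Function.update w s(o, y) 1)).real (openConn a₀ b)) →
      (prodBernoulli (Function.update w s(o, y) 1)).real (⋃ a ∈ A, openConn o a)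
          - (1 - (prodBernoulli (Function.update w s(o, y) 1)).real (openConn a₀ b))
        ≤ (prodBernoulli (Function.update w s(o, y) 1)).real (openConn o b)) :
    ∀ (n : ℕ) (w : Sym2 (Fin n) → unitInterval) (A : Finset (Fin n)) (o b : Fin n) (t : ℝ), 0 ≤ t →
      (∀ a ∈ A, 1 - t ≤ (prodBernoulli w).real (openConn a b)) →
      (prodBernoulli w).real (⋃ a ∈ A, openConn o a) - t ≤ (prodBernoulli w).real (openConn o b) := by
  intro n w A o b t ht hA
  rcases A.eq_empty_or_nonempty with hAe | hAne
  · subst hAe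
    simp only [Finset.notMem_empty, Set.iUnion_of_empty, Set.iUnion_empty, measureReal_empty]
    linarith [measureReal_nonneg (μ := prodBernoulli w) (s := openConn o b)]
  · have key := addConj1_of_stubs hSure (starGlue_of_stubs hRelay hSmall hDrift) n w A o b (1 - t) hAne
      (fun a ha => hA a ha)
    linarith

/-- **The crux BY NAME, from the four registered stubs** (the skeleton's closing theorem). -/
theorem additiveGluing_closed : AdditiveGluing :=
  additiveGluing_of_shapes stub_sureStar_sg stub_starGlueRelay_sg stub_starGlueSmall_sg stub_starGlueDrift_sg

end Summit.CriticalPhenomena.PercolationContinuityZ3.Cruxes.AdditiveGluing.StarGlue
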